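import Literature.NumberTheory.EllipticCurves.Kato2004.EulerSystemBoundFineSelmer
import Literature.NumberTheory.EllipticCurves.Kato2004.IwasawaH1ProjZeroKernelProofs
import Literature.NumberTheory.EllipticCurves.Kato2004.IwasawaH1LambdaTorsionFreeProofs
import Literature.NumberTheory.EllipticCurves.KatoRankBoundProofs
import Literature.NumberTheory.EllipticCurves.KatoFineSelmerFiniteProofs
import HarnessLib

/-!
# Kato 2004 (Astérisque 295) Thm. 13.4: clause (2) at the prime `(T)` already gives clause (1) on the
# fine part — `X₀(W/ℚ_∞)` is `Λ`-TORSION as soon as one genuine Euler-system class `s` with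
# `𝐇¹_Γ(T_pW)/Λs` torsion is available (proofs only; no definition, no named fact)

Topic `NumberTheory/EllipticCurves`, sub-directory `Kato2004` (namespace = path). Cell `bsd-potss`
(HOME `run/shared/lean/pub/bsd-potss/`), seat `bsd-potss-k8q-c2x` g7 (prover; WIDTH-LEVER lane B of the
K8 Kato side, crux stmt-BirchSwinnertonDyer-20445 `PlusKatoDivisibilityBranchOnto`, held aliases
21362 `Kobayashi2003.thm62_63_73_etaColemanPoitouTate_zeta` (hZ) / 21363
`Kato2004.thm13_4_lengthAt_fineSelmerDual_le_of_isEulerSystemClass` (h134) / 21364 (h12)). HONEST FRAMING: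
the programme assembles BSD for analytic rank `≤ 1` strictly from published theorems and TYPES the
remainder; BSD is not proved by any of this; nothing is booked; this file closes no item. It is a
HARDENING file for the trust base of crux 20445: it shows that one printed sentence the tree holds as an
independent input — "`X⁰(E/K_∞)` is a torsion `Λ`-module" (Kobayashi 2003 Cor. 7.2 = Kato Thm. 12.4 (1)
read on the fine Selmer group; in the tree: the FIELD `isTorsion_fine` of
`Kobayashi2003.EtaColemanPoitouTateData`, and the named facts `Kato2004_fineSelmerDual_isTorsion`,
`Kim2022_fineSelmerDual_isTorsion`) — is, on every row where Kato's hypothesis (v) holds, a KERNEL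
CONSEQUENCE of the named fact h134 (Thm. 13.4 (2)) and of ONE genuine Euler-system class `s` with
`𝐇¹_Γ(T_pW)/Λs` torsion (e.g. `s` in the image-complement of an injective `Λ`-linear functional — the
Coleman composite of hZ — or any `s ≠ 0` once `rank_Λ 𝐇¹_Γ ≤ 1`, Kato Thm. 12.4 (2)).

## What is proved (everything a theorem)

* §1 `Module.isTorsion_of_lengthAt_ne_top` — commutative algebra, any domain `R`: if the localisation
  `M_𝔭` at a NON-ZERO prime `𝔭` has finite length over `R_𝔭`, then `M` is a torsion `R`-module (every
  `x ∈ M`: the chain `R_𝔭 aⁿx` (`0 ≠ a ∈ 𝔭`) is stationary in the Artinian `M_𝔭`, `(1 − ab)aⁿx = 0` with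
  `1 − ab ∈ R_𝔭ˣ`, so `u aⁿ x = 0` for some `u ∉ 𝔭`). Specialisations to `Λ = ℤ_p⟦T⟧` at `𝔭 = (T)`
  (`IwasawaAlgebra.isTorsion_of_lengthAt_primeT_ne_top`) and `p ∉ (T)` (private).
* §2 (private helpers) `H/Rs` is torsion when an injective functional `c : H → R` has `c s ≠ 0`, resp.
  when `H` has no zero smul-divisors, `rank_R H ≤ 1` and `s ≠ 0`.
* §3 **`Kato2004.isTorsion_fineSelmerDual_of_thm13_4`** — for `W/ℚ` elliptic, `p` odd, the cyclotomic
  pin `(I, FB)`, a genuine Euler-system class `s ∈ 𝐇¹_Γ(T_pW)` (`IsEulerSystemClass`), Kato's (v) for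
  `T_pW`, and `𝐇¹_Γ/Λs` torsion: h134 ⟹ `X₀(W/ℚ_∞) = FB.X` is `Λ`-torsion. Proof: clause (2) of h134 at
  the height-one prime `(T) ∌ p` (`IwasawaAlgebra.primeT`, `height_primeT`) bounds `ℓ_{(T)}(X₀)` by
  `ℓ_{(T)}(𝐇¹_Γ/Λs) < ⊤` (`lengthAt_primeT_ne_top`, the quotient being finitely generated torsion:
  (12.2.1) `IwasawaH1Data.module_finite_of_isCyclotomic`), then §1. Variants: `…_of_injective`
  (functional), `…_of_rank_le_one` (with the tree theorem `IwasawaH1Data.noZeroSMulDivisors`),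
  `…_of_thm12_4` (rank from the named fact `Kato2004.thm12_4` BY NAME), and the fact-level reading
  `fineSelmerDual_isTorsion_of_thm13_4_of_thm12_4_of_exists_isEulerSystemClass`: at an odd `p` where (v)
  holds and ONE non-zero genuine Euler-system class exists, the conclusion of
  `Kato2004_fineSelmerDual_isTorsion` for `W` follows from `{h134, thm12_4}`.

## Why (K8 lane B census, g7)

On the K8 Kato side the package hZ carries Cor. 7.2 as the field `isTorsion_fine`, consumed by
`EulerSystemBound.kato_rational_of_zeta` / `kato_integral_of_zeta` / `etaKatoDivisibility_of_zeta_of_thm13_4`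
(Summits, `…PlusKatoDivisibilityOfEulerSystemBound{,Rows}`). With this file that field is IDLE on every
row the crux 20445 quantifies over (tower-onto ⟹ (v), `Condition1252QuadraticTwistProofs`) and on every
non-CM row ((v) ⟺ non-CM, `ConditionVOfNotHasCMProofs` / `ConditionVIffNotHasCMProofs`): the other fields
`z`, `colPlus`, `colPlus_injective`, `isPlus_colPlus_z` (`⟹ Col⁺ z ≠ 0`, Rohrlich), `isEulerSystemClass_z`
and h134 give it (Summits-side record `…PlusKatoDivisibilityCor72OfThm134.lean`, same seat). In print this
is exactly Kato's own order of proof (13.4 (2) ⟹ 12.4 (1) via §13.8–13.13), so nothing here is stronger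
than print. NOT addressed: `colPlus_injective` (Kobayashi Thm. 7.3 i)) — on the road it is EQUIVALENT to
`rank_Λ 𝐇¹_Γ(T_pW) ≤ 1` (Kato Thm. 12.4 (2), Euler-system-borne), a swap and not a reduction; the `𝐇²`
reading `Kato-134-H20-fine` (no `𝐇²` object in the tree).

References: [Kato2004Asterisque] Thm. 12.4 (1)(2) (p. 221), §12.2 (12.2.1) (p. 220), Thm. 13.4 (p. 226),
§13.8–13.13 (pp. 228–233); [Kobayashi2003] Cor. 7.2 and Thm. 7.3 i) (p. 13); [Kim2022StructureSelmer]
Thm. 4.5 (2)/4.6 (2); [Washington1997] §13.2 (`(T)` has height one; local lengths); Bourbaki AC VII §4.4.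
Tree: `Kato2004/EulerSystemBoundFineSelmer.lean` (h134), `Kato2004/IwasawaCohomology.lean` (`thm12_4`),
`Kato2004/IwasawaH1{ProjZeroKernel,LambdaTorsionFree}Proofs.lean`, `KatoRankBoundProofs.lean` (`primeT`),
`KatoFineSelmerDualTorsion.lean` (the two `X₀`-torsion facts), `IwasawaAlgebraProofs.lean`
(`lengthAt_ne_top_of_isTorsionBy`, the converse direction).
-/

noncomputable section

open scoped Classical

open Field
open Literature.NumberTheory.GaloisRepresentations
open Literature.NumberTheory.EllipticCurves
open Literature.NumberTheory.EllipticCurves.IwasawaAlgebra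

namespace Literature.NumberTheory.EllipticCurves

/-! ## §1 Finite length at ONE non-zero prime forces torsion -/

namespace Module

variable {R : Type*} [CommRing R] {M : Type*} [AddCommGroup M] [_root_.Module R M]

/-- **Finite local length at a non-zero prime forces torsion.** Over a domain `R`, if the localised
module `M_𝔭` has finite length over `R_𝔭` for some prime `𝔭 ≠ 0`, then every element of `M` is killed
by a non-zero-divisor: for `x ∈ M` and `0 ≠ a ∈ 𝔭`, the descending chain `R_𝔭·aⁿ(x/1)` in the Artinian
module `M_𝔭` is stationary, so `aⁿ(x/1) = b·aⁿ⁺¹(x/1)` and `(1 − ba)·aⁿ(x/1) = 0` with `1 − ba` a unit of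
the local ring `R_𝔭`; hence `u·aⁿ·x = 0` for some `u ∉ 𝔭`. (Converse companion of the tree lemma
`lengthAt_ne_top_of_isTorsionBy`; a two-line consequence of "finite length ⟺ both chain conditions",
Atiyah–Macdonald Prop. 6.8, applied to the cyclic submodules of `M_𝔭`, and of the units of a local ring.)
[cite: AtiyahMacdonald1969, Ch. 6, Prop. 6.8 (modules of finite length satisfy the d.c.c.) with Ch. 1, Prop. 1.9 (1 − x is a unit for x in the Jacobson radical)] -/
theorem isTorsion_of_lengthAt_ne_top [IsDomain R] (𝔭 : PrimeSpectrum R) (h𝔭 : 𝔭.asIdeal ≠ ⊥)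
    (h : lengthAt R M 𝔭 ≠ ⊤) : Module.IsTorsion R M := by
  have hfl : IsFiniteLength (Localization.AtPrime 𝔭.asIdeal)
      (LocalizedModule 𝔭.asIdeal.primeCompl M) := Module.length_ne_top_iff.mp h
  haveI : IsArtinian (Localization.AtPrime 𝔭.asIdeal)
      (LocalizedModule 𝔭.asIdeal.primeCompl M) :=
    (isFiniteLength_iff_isNoetherian_isArtinian.mp hfl).2
  obtain ⟨a, ha𝔭, ha0⟩ := Submodule.exists_mem_ne_zero_of_ne_bot h𝔭
  intro x
  set A := Localization.AtPrime 𝔭.asIdeal with hA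
  set x₁ : LocalizedModule 𝔭.asIdeal.primeCompl M := LocalizedModule.mk x 1 with hx₁
  set r : A := algebraMap R A a with hr
  -- the descending chain `A · rⁿ x₁` inside the cyclic (Artinian) submodule `A · x₁` is stationary
  obtain ⟨n, y, hy⟩ := IsArtinian.exists_pow_succ_smul_dvd (R := A)
    (M := Submodule.span A ({x₁} : Set (LocalizedModule 𝔭.asIdeal.primeCompl M))) r
    ⟨x₁, Submodule.mem_span_singleton_self x₁⟩
  obtain ⟨b, hb⟩ := Submodule.mem_span_singleton.mp y.2
  have hy' : r ^ (n + 1) • (b • x₁) = r ^ n • x₁ := by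
    have h' := congrArg Subtype.val hy
    simp only [Submodule.coe_smul] at h'
    rw [← hb] at h'
    exact h'
  -- `(1 - b r) • rⁿ x₁ = 0`
  have hkill : (1 - b * r) • (r ^ n • x₁) = (1 - b * r) • 0 := by
    rw [smul_zero, sub_smul, one_smul, smul_smul, mul_assoc, ← pow_succ', ← smul_smul, smul_comm b,
      hy', sub_self]
  -- `1 - b r` is a unit of the local ring `A` (`r ∈ 𝔪_A`)
  have hunit : IsUnit (1 - b * r) := by
    refine IsLocalRing.isUnit_one_sub_self_of_mem_nonunits _ ?_
    rw [← IsLocalRing.mem_maximalIdeal]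
    exact Ideal.mul_mem_left _ b
      ((IsLocalization.AtPrime.to_map_mem_maximal_iff A 𝔭.asIdeal a).mpr ha𝔭)
  have hrn : r ^ n • x₁ = 0 := (hunit.smul_left_cancel).mp hkill
  -- back to `M`: `u • aⁿ • x = 0` for some `u ∉ 𝔭`
  have hmk : LocalizedModule.mk (a ^ n • x) (1 : 𝔭.asIdeal.primeCompl) =
      LocalizedModule.mk 0 1 := by
    rw [LocalizedModule.zero_mk, ← LocalizedModule.smul'_mk, ← hx₁, ← algebraMap_smul A (a ^ n) x₁,
      map_pow, ← hr, hrn]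
  obtain ⟨u, hu⟩ := LocalizedModule.mk_eq.mp hmk
  simp only [one_smul, smul_zero] at hu
  have hu0 : (u : R) ≠ 0 := fun h0 => u.2 (by rw [h0]; exact 𝔭.asIdeal.zero_mem)
  refine ⟨⟨(u : R) * a ^ n, mem_nonZeroDivisors_of_ne_zero (mul_ne_zero hu0 (pow_ne_zero n ha0))⟩, ?_⟩
  rw [Submonoid.mk_smul, mul_smul]
  rw [Submonoid.smul_def] at hu
  exact hu

/-! ## §2 Rank-one algebra: `H/Rs` is torsion -/

/-- For an injective `R`-linear functional `c : H → R` and `s ∈ H` with `c s ≠ 0`, the quotient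
`H/Rs` is a torsion `R`-module: it is killed by `c s` (`c(s)·x − c(x)·s ∈ ker c = 0`). Private helper
of §3. [folklore] -/
private theorem isTorsion_quotient_span_singleton_of_injective [IsDomain R] {H : Type*} [AddCommGroup H]
    [_root_.Module R H] (c : H →ₗ[R] R) (hc : Function.Injective c) (s : H) (hs : c s ≠ 0) :
    Module.IsTorsion R (H ⧸ Submodule.span R {s}) := by
  intro x
  refine ⟨⟨c s, mem_nonZeroDivisors_of_ne_zero hs⟩, ?_⟩
  rw [Submonoid.mk_smul]
  induction x using Submodule.Quotient.induction_on with
  | H m =>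
    rw [← Submodule.Quotient.mk_smul, Submodule.Quotient.mk_eq_zero, Submodule.mem_span_singleton]
    refine ⟨c m, hc ?_⟩
    rw [map_smul, map_smul, smul_eq_mul, smul_eq_mul, mul_comm]

/-- Over a domain, if `H` has no zero smul-divisors and `rank_R H ≤ 1`, then for every `s ≠ 0` the
quotient `H/Rs` is a torsion `R`-module: any `x` is `R`-dependent with `s`, `a x + b s = 0` with
`(a, b) ≠ 0`, and `a = 0` would force `b s = 0`, `s = 0`. Private helper of §3. [folklore] -/
private theorem isTorsion_quotient_span_singleton_of_rank_le_one [IsDomain R] {H : Type*} [AddCommGroup H]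
    [_root_.Module R H] [NoZeroSMulDivisors R H] (hrk : Module.rank R H ≤ 1) {s : H} (hs : s ≠ 0) :
    Module.IsTorsion R (H ⧸ Submodule.span R {s}) := by
  intro x
  induction x using Submodule.Quotient.induction_on with
  | H m =>
    -- `m`, `s` are `R`-dependent
    have hdep : ∃ a b : R, (a ≠ 0 ∨ b ≠ 0) ∧ a • m + b • s = 0 := by
      by_contra hcon
      push Not at hcon
      have hli : LinearIndependent R ![m, s] := by
        rw [LinearIndependent.pair_iff]
        intro a b hab
        by_contra hne
        exact hcon a b (not_and_or.mp hne) hab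
      have h2 : (2 : Cardinal) ≤ Module.rank R H := by
        simpa using hli.cardinal_lift_le_rank
      have h21 : (2 : Cardinal) ≤ 1 := h2.trans hrk
      norm_num at h21
    obtain ⟨a, b, hab, h0⟩ := hdep
    have ha : a ≠ 0 := by
      rintro rfl
      rw [zero_smul, zero_add] at h0
      rcases hab with h | h
      · exact h rfl
      · exact h ((smul_eq_zero.mp h0).resolve_right hs)
    refine ⟨⟨a, mem_nonZeroDivisors_of_ne_zero ha⟩, ?_⟩
    rw [Submonoid.mk_smul, ← Submodule.Quotient.mk_smul, Submodule.Quotient.mk_eq_zero,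
      Submodule.mem_span_singleton]
    refine ⟨-b, ?_⟩
    rw [neg_smul, eq_comm, eq_neg_iff_add_eq_zero, h0]

end Module

/-! ## §1′ The Iwasawa algebra: the prime `(T)` -/

namespace IwasawaAlgebra

variable (p : ℕ) [Fact p.Prime]

/-- `(T) ≠ 0` in `Λ = ℤ_p⟦T⟧`. Private helper of §3. [folklore] -/
private theorem primeT_asIdeal_ne_bot : (primeT p).asIdeal ≠ ⊥ := by
  rw [primeT_asIdeal, Ne, Ideal.span_singleton_eq_bot]
  exact PowerSeries.X_ne_zero

/-- `p ∉ (T)`: the constant power series `p` has non-zero constant coefficient. Private helper of §3.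
[folklore] -/
private theorem C_natCast_not_mem_primeT : PowerSeries.C (p : ℤ_[p]) ∉ (primeT p).asIdeal := by
  rw [primeT_asIdeal, Ideal.mem_span_singleton, PowerSeries.X_dvd_iff, PowerSeries.constantCoeff_C]
  exact_mod_cast (Fact.out : p.Prime).ne_zero

variable {p} in
/-- **Finite length at `(T)` forces `Λ`-torsion**: a `Λ`-module `X` with `length_{Λ_{(T)}} X_{(T)} < ∞`
is a torsion `Λ`-module (§1 at the non-zero prime `(T)`: in Washington's classification, §13.2, a
finitely generated `Λ`-module with `X_{(T)}` of finite length has no free part `Λ^r`).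
[cite: Washington1997, §13.2, Thm. 13.12 and Lemma 13.7 (the height-one primes (p), (f(T)) of Λ and the structure theorem)] -/
theorem isTorsion_of_lengthAt_primeT_ne_top (X : Type*) [AddCommGroup X] [Module (IwasawaAlgebra p) X]
    (h : Module.lengthAt (IwasawaAlgebra p) X (primeT p) ≠ ⊤) :
    Module.IsTorsion (IwasawaAlgebra p) X :=
  Module.isTorsion_of_lengthAt_ne_top (primeT p) (primeT_asIdeal_ne_bot p) h

end IwasawaAlgebra

/-! ## §3 Kato Thm. 13.4: clause (2) at `(T)` gives clause (1) on the fine part -/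

namespace Kato2004

open Literature.NumberTheory.EllipticCurves.Kato2004.EulerSystemValues

variable {W : WeierstrassCurve ℚ} [W.IsElliptic] {p : ℕ} [Fact p.Prime]
  [ContinuousSMul ℤ_[p] (W.tateModule p)] [Module.Free ℤ_[p] (W.tateModule p)]
  [Module.Finite ℤ_[p] (W.tateModule p)] {κ : ZpExtension ℚ p} {γ : absoluteGaloisGroup ℚ}

/-- **Kato Thm. 13.4 (1) on the fine part, from Thm. 13.4 (2) at the prime `(T)`.** For `W/ℚ` elliptic,
`p` odd, the cyclotomic pin `(𝐇¹_Γ(T_pW), X₀(W/ℚ_∞)) = (I, FB)`, a GENUINE Euler-system class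
`s ∈ 𝐇¹_Γ(T_pW)` for which `𝐇¹_Γ/Λs` is torsion, and Kato's hypothesis (v) for `T_pW`: the named fact
`thm13_4_lengthAt_fineSelmerDual_le_of_isEulerSystemClass` implies that `X₀(W/ℚ_∞)` is a torsion
`Λ`-module. Proof: clause (2) at `𝔭 = (T)` (height one, `p ∉ (T)`) gives
`ℓ_{(T)}(X₀) ≤ ℓ_{(T)}(𝐇¹_Γ/Λs) < ⊤` (the quotient is finitely generated torsion, (12.2.1)), and finite
length at one non-zero prime forces torsion (§1). (`s ≠ 0` follows from the torsion hypothesis unless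
`𝐇¹_Γ` itself is torsion, in which case `𝐇¹_Γ = 0` by torsion-freeness and the class is useless; we keep
`s ≠ 0` as the fact's binder.) CONDITIONAL on h134. [cite: Kato2004Asterisque, Thm. 13.4 (1)(2) (p. 226), Thm. 12.4 (1) (p. 221), §12.2 (12.2.1) (p. 220)]
[cite: Kobayashi2003, Cor. 7.2 (p. 13)] -/
theorem isTorsion_fineSelmerDual_of_thm13_4
    (h134 : thm13_4_lengthAt_fineSelmerDual_le_of_isEulerSystemClass)
    (hp : p ≠ 2) (hκ : κ.IsCyclotomic) (hγ : κ.IsTopGenerator γ)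
    (I : IwasawaH1Data W p κ γ) (FB : W.FineSelmerDualData κ γ) {s : I.H}
    (hs : IsEulerSystemClass W p κ γ I s) (hs0 : s ≠ 0)
    (hv : ∃ σ : absoluteGaloisGroup ℚ,
      (∀ (n : ℕ) (t : AlgebraicClosure ℚ), t ^ p ^ n = 1 → σ • t = t) ∧
        Module.finrank ℤ_[p]
          ((W.tateModule p) ⧸ LinearMap.range (W.galoisRepTate p σ - 1)) = 1)
    (hq : Module.IsTorsion (IwasawaAlgebra p) (I.H ⧸ Submodule.span (IwasawaAlgebra p) {s})) :
    Module.IsTorsion (IwasawaAlgebra p) FB.X := by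
  haveI : Module.Finite (IwasawaAlgebra p) I.H := IwasawaH1Data.module_finite_of_isCyclotomic hκ hγ I
  obtain ⟨h2, -⟩ := h134 W p κ γ hp hκ hγ I FB s hs hs0 hv
  have hle := h2 (primeT p) (height_primeT p) (IwasawaAlgebra.C_natCast_not_mem_primeT p)
  have hH : Module.lengthAt (IwasawaAlgebra p) (I.H ⧸ Submodule.span (IwasawaAlgebra p) {s})
      (primeT p) ≠ ⊤ :=
    lengthAt_primeT_ne_top _ hq
  exact IwasawaAlgebra.isTorsion_of_lengthAt_primeT_ne_top FB.X (ne_top_of_le_ne_top hH hle)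

/-- **The functional form** (the shape of the K8 road): if an INJECTIVE `Λ`-linear `c : 𝐇¹_Γ(T_pW) → Λ`
(e.g. Kobayashi's `Col⁺ ∘ loc` at `η`) does not vanish at the genuine Euler-system class `s`, then under
(v) the named fact h134 implies `X₀(W/ℚ_∞)` is `Λ`-torsion. CONDITIONAL on h134.
[cite: Kato2004Asterisque, Thm. 13.4 (2) (p. 226)] [cite: Kobayashi2003, Thm. 7.3 i) and Cor. 7.2 (p. 13)] -/
theorem isTorsion_fineSelmerDual_of_thm13_4_of_injective
    (h134 : thm13_4_lengthAt_fineSelmerDual_le_of_isEulerSystemClass)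
    (hp : p ≠ 2) (hκ : κ.IsCyclotomic) (hγ : κ.IsTopGenerator γ)
    (I : IwasawaH1Data W p κ γ) (FB : W.FineSelmerDualData κ γ) {s : I.H}
    (hs : IsEulerSystemClass W p κ γ I s)
    (hv : ∃ σ : absoluteGaloisGroup ℚ,
      (∀ (n : ℕ) (t : AlgebraicClosure ℚ), t ^ p ^ n = 1 → σ • t = t) ∧
        Module.finrank ℤ_[p]
          ((W.tateModule p) ⧸ LinearMap.range (W.galoisRepTate p σ - 1)) = 1)
    (c : I.H →ₗ[IwasawaAlgebra p] IwasawaAlgebra p) (hc : Function.Injective c) (hcs : c s ≠ 0) :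
    Module.IsTorsion (IwasawaAlgebra p) FB.X :=
  isTorsion_fineSelmerDual_of_thm13_4 h134 hp hκ hγ I FB hs (fun h0 => hcs (by rw [h0, map_zero])) hv
    (Module.isTorsion_quotient_span_singleton_of_injective c hc s hcs)

/-- **The rank form**: if `rank_Λ 𝐇¹_Γ(T_pW) ≤ 1` (Kato Thm. 12.4 (2); `𝐇¹_Γ` is torsion free by the
tree theorem `IwasawaH1Data.noZeroSMulDivisors`), then for every non-zero genuine Euler-system class
`s` and under (v), h134 implies `X₀(W/ℚ_∞)` is `Λ`-torsion. CONDITIONAL on h134.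
[cite: Kato2004Asterisque, Thm. 12.4 (2) (p. 221) and Thm. 13.4 (2) (p. 226)] -/
theorem isTorsion_fineSelmerDual_of_thm13_4_of_rank_le_one
    (h134 : thm13_4_lengthAt_fineSelmerDual_le_of_isEulerSystemClass)
    (hp : p ≠ 2) (hκ : κ.IsCyclotomic) (hγ : κ.IsTopGenerator γ)
    (I : IwasawaH1Data W p κ γ) (FB : W.FineSelmerDualData κ γ)
    (hrk : Module.rank (IwasawaAlgebra p) I.H ≤ 1) {s : I.H}
    (hs : IsEulerSystemClass W p κ γ I s) (hs0 : s ≠ 0)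
    (hv : ∃ σ : absoluteGaloisGroup ℚ,
      (∀ (n : ℕ) (t : AlgebraicClosure ℚ), t ^ p ^ n = 1 → σ • t = t) ∧
        Module.finrank ℤ_[p]
          ((W.tateModule p) ⧸ LinearMap.range (W.galoisRepTate p σ - 1)) = 1) :
    Module.IsTorsion (IwasawaAlgebra p) FB.X :=
  haveI := I.noZeroSMulDivisors hγ
  isTorsion_fineSelmerDual_of_thm13_4 h134 hp hκ hγ I FB hs hs0 hv
    (Module.isTorsion_quotient_span_singleton_of_rank_le_one hrk hs0)

/-- **With Kato Thm. 12.4 BY NAME** (`Kato2004.thm12_4`, a held named fact: `rank_Λ 𝐇¹_Γ = 1`): for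
every non-zero genuine Euler-system class `s` and under (v), `{h134, thm12_4}` imply `X₀(W/ℚ_∞)` is
`Λ`-torsion. CONDITIONAL on the two named facts. [cite: Kato2004Asterisque, Thm. 12.4 (1)(2) (p. 221) and Thm. 13.4 (p. 226)] -/
theorem isTorsion_fineSelmerDual_of_thm13_4_of_thm12_4
    (h134 : thm13_4_lengthAt_fineSelmerDual_le_of_isEulerSystemClass) (h124 : thm12_4)
    (hp : p ≠ 2) (hκ : κ.IsCyclotomic) (hγ : κ.IsTopGenerator γ)
    (I : IwasawaH1Data W p κ γ) (FB : W.FineSelmerDualData κ γ) {s : I.H}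
    (hs : IsEulerSystemClass W p κ γ I s) (hs0 : s ≠ 0)
    (hv : ∃ σ : absoluteGaloisGroup ℚ,
      (∀ (n : ℕ) (t : AlgebraicClosure ℚ), t ^ p ^ n = 1 → σ • t = t) ∧
        Module.finrank ℤ_[p]
          ((W.tateModule p) ⧸ LinearMap.range (W.galoisRepTate p σ - 1)) = 1) :
    Module.IsTorsion (IwasawaAlgebra p) FB.X :=
  isTorsion_fineSelmerDual_of_thm13_4_of_rank_le_one h134 hp hκ hγ I FB
    (thm12_4.isTorsionFree_and_rank_le_one h124 W p hκ hγ I).2 hs hs0 hv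

/-- **Fact-level reading.** At an odd prime `p` where Kato's (v) holds for `T_pW`, if ONE non-zero
genuine Euler-system class exists in some cyclotomic pin of `𝐇¹_Γ(T_pW)`, then `{h134, thm12_4}` give
the conclusion of the named fact `Kato2004_fineSelmerDual_isTorsion` for `W` at `p`: every Pontryagin
dual datum of `Sel₀(ℚ_∞, W[p^∞])` is `Λ`-torsion (the structure facts of `T_pW` are instance BINDERS as
in h134, discharged by the tree theorems `module_free_tateModule_holds` / `module_finite_tateModule_holds`).
CONDITIONAL on the two named facts; the Euler-system class is displayed, NOT constructed (Kato's zeta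
elements, Thm. 12.5/12.6, Ex. 13.3). [cite: Kato2004Asterisque, Thm. 12.4 (1) (p. 221), Thm. 13.4 (p. 226), Ex. 13.3 (p. 225)]
[cite: Kim2022StructureSelmer, Thm. 4.5 (2) (journal) = Thm. 4.6 (2) (arXiv)] -/
theorem fineSelmerDual_isTorsion_of_thm13_4_of_thm12_4_of_exists_isEulerSystemClass
    (h134 : thm13_4_lengthAt_fineSelmerDual_le_of_isEulerSystemClass) (h124 : thm12_4)
    (hp : p ≠ 2) (hκ : κ.IsCyclotomic) (hγ : κ.IsTopGenerator γ)
    (hv : ∃ σ : absoluteGaloisGroup ℚ,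
      (∀ (n : ℕ) (t : AlgebraicClosure ℚ), t ^ p ^ n = 1 → σ • t = t) ∧
        Module.finrank ℤ_[p]
          ((W.tateModule p) ⧸ LinearMap.range (W.galoisRepTate p σ - 1)) = 1)
    (hES : ∃ (I : IwasawaH1Data W p κ γ) (s : I.H), IsEulerSystemClass W p κ γ I s ∧ s ≠ 0) :
    ∀ Y : W.FineSelmerDualData κ γ, Module.IsTorsion (IwasawaAlgebra p) Y.X := by
  intro Y
  obtain ⟨I, s, hs, hs0⟩ := hES
  exact isTorsion_fineSelmerDual_of_thm13_4_of_thm12_4 h134 h124 hp hκ hγ I Y hs hs0 hv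

end Kato2004

end Literature.NumberTheory.EllipticCurves

end
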